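import Literature.MathematicalPhysics.QuantumFieldTheory.Balaban1983to89.B12B0LoopStructure267
import Literature.MathematicalPhysics.QuantumFieldTheory.Balaban1983to89.BlockAveragingEMLLinearisedBackground
import Literature.MathematicalPhysics.QuantumFieldTheory.Balaban1983to89.MatrixLogLipschitz

/-!
# [Balaban1987RG1] p. 266–267 «restrictions on B′(b₀(c)), with the constant ε₁ replaced by O(ε₁)» — THE NONLINEAR RIDER AT THE
# AVERAGING (0.4) WITH THE PRINTED `exp[mean log]` ON `SU(N)`: on the fibre `M(U)(c) = M(V)(c)`, a fluctuation `U = V·F` that is `ε`-small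
# at every bond except the distinguished ones is `O(ε)`-small at `b₀(c)` too

Cell `pub-ymgap` (YM-PLAN Track A), seat `pub-ymgap-dag-n09-w4` g3; helper toward K1⁷ `StabilityBAtRecordR13SepCoPH` (stmt-QuantumFields-20542),
count-neutral; the N09 binder `hb0` of the atDomAlt doors (dag-n09-w3 g2 `…AtSmallFieldBookkeeping`, K0e `mem_domAltOfRecord_of_chiFix29_eq_one`).

PRINT.  p. 266–267 (after (2.9)): *«The above restrictions imply also restrictions on B′(b₀(c)), with the constant ε₁ replaced by O(ε₁),
because these variables can be expressed in terms of the remaining ones as in the first step.»*  The tree had this at the LINEAR level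
(lit-balaban r09 `B12B0Restriction267` ∕ `…Average267` ∕ `…MainTerm`: «nothing of the nonlinear elimination is claimed»); here it is proved
NONLINEARLY, at the group level, for the averaging the programme uses (`BlockAveraging.avgFun ExpMeanLog.expMeanLogSU`).

THE MECHANISM (kernel).  Fix a coarse bond `c`, a background `V` whose (0.4) loop variables at `c` are `α`-small, and `U` with `M(U)(c) = M(V)(c)`
and `|U_bV_b⁻¹ − 1| ≤ ε` off the distinguished bonds.  By `B12B0LoopStructure267`, with `T` = the fluctuation at `b₀(c)` transported to the block
centre and `V₁ = V` with `U(b₀(c))` at `b₀(c)`: `V₁(c) = T·V(c)`, `W_i(V₁) = W_i(V)·T⁻¹` off the axis, `= T·W_i(V)·T⁻¹` on it; the loops at `c` never see a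
foreign `b₀(c′)`, so `U` is an `ε`-perturbation of `V₁` along every segment (`BlockAveragingEMLLinearisedBackground.norm_holRatio_bounds_of_length_le`:
factors `R` within `2ℓε`, `ℓ = (d+2)L`).  The fibre identity becomes `κ_U·R_S·T = κ_V` (§3) with `κ_U` the guarded `exp[mean log]` of the family
`{R_iW_iT⁻¹}_{off} ∪ {R_iTW_iT⁻¹}_{on}`.  §1 (GLOBAL, series-log Lipschitz `MatrixLogLipschitz`): on the guard, `mean log = −(1−λ)log T + O(ℓε + α)`
(`λ = |on|∕|I|`), and `exp(mean log) = κ_V T⁻¹R_S⁻¹ ≈ T⁻¹ = exp(−log T)`, whence `λ|log T| = O(ℓε + α)`; off the guard `κ_U = 1` forces `T ≈ 1`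
while a large member forces `T` far from `1` — impossible.  §2 (PERTURBATIVE, the tree's analytic-mean increment lemma `norm_eml_add_sub_sub_mean_le`
at the background family, where the `α`-terms CANCEL): `λ|T − 1| ≤ O(ℓε) + O((ℓε + α + |T−1|)·|T−1|)`, so with §1's a-priori bound, `|T − 1| ≤ 16ℓε∕λ`
under the displayed numerics `1640(2ℓε + α) ≤ λ²`, `13(2ℓε + α) < λ·δ_N`.

WHAT IS PROVED.  §1–§2 abstract (any finite index type, families in `SU(N)`): `stage1_dist1_le`, `stage2_dist1_le`, `dist1_le_of_fibre_identity`.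
§3 the rider at the averaging of record: ★ `norm_pertVar_b0_le` — `‖U(b₀(c))V(b₀(c))⁻¹ − 1‖ ≤ 16ℓε·|I|∕|on-axis indices|` (`= 16(d+2)L^d ε`).

HONEST FRAMING: kernel matrix analysis + the tree's [B7] Props 2∕3-type lemmas BY NAME; the printed p. 266–267 sentence becomes a theorem for
(0.4); NOTHING ELSE of Bałaban's asserted; numerics displayed; no summit statement touched; one finite four-torus programme downstream — not continuum
∕ ℝ⁴ ∕ OS ∕ mass gap ∕ Clay.  Theorems only (0 `def`, 0 `sorry`).
-/

noncomputable section

open scoped BigOperators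

namespace Literature.MathematicalPhysics.QuantumFieldTheory.Balaban1983to89

namespace B12B0RestrictionNonlinear267

open ExpMeanLog MatrixLog MatrixLogLipschitz NormedSpace
open scoped Matrix.Norms.L2Operator

/-! ## §0 Letters: `SU(N)` elements as matrices -/

section SU

variable {n : Type*} [Fintype n] [DecidableEq n]

/-- An element of `SU(N)` is unitary. [folklore] -/
private theorem coe_mem_unitaryGroup (g : Matrix.specialUnitaryGroup n ℂ) : (g : Matrix n n ℂ) ∈ Matrix.unitaryGroup n ℂ :=
  (Matrix.mem_specialUnitaryGroup_iff.1 g.2).1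

/-- The inverse in `SU(N)` is the conjugate transpose (coercion lemma). [folklore] -/
private theorem coe_inv_eq_star (g : Matrix.specialUnitaryGroup n ℂ) :
    ((g⁻¹ : Matrix.specialUnitaryGroup n ℂ) : Matrix n n ℂ) = star (g : Matrix n n ℂ) := rfl

/-- `g·g⁻¹ = 1` as matrices. [folklore] -/
private theorem coe_mul_inv (g : Matrix.specialUnitaryGroup n ℂ) :
    (g : Matrix n n ℂ) * ((g⁻¹ : Matrix.specialUnitaryGroup n ℂ) : Matrix n n ℂ) = 1 := by
  rw [← Submonoid.coe_mul, mul_inv_cancel]; rfl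

/-- `‖X·g‖ = ‖X‖`. [folklore] -/
private theorem norm_mul_coe (X : Matrix n n ℂ) (g : Matrix.specialUnitaryGroup n ℂ) : ‖X * (g : Matrix n n ℂ)‖ = ‖X‖ :=
  CStarRing.norm_mul_mem_unitary X (coe_mem_unitaryGroup g)

/-- `‖g·X‖ = ‖X‖`. [folklore] -/
private theorem norm_coe_mul (g : Matrix.specialUnitaryGroup n ℂ) (X : Matrix n n ℂ) : ‖(g : Matrix n n ℂ) * X‖ = ‖X‖ :=
  CStarRing.norm_mem_unitary_mul X (coe_mem_unitaryGroup g)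

variable [Nonempty n]

/-- `dist1 g = ‖g − 1‖` on `SU(N)` (`rfl`). [folklore] -/
private theorem dist1_eq (g : Matrix.specialUnitaryGroup n ℂ) : dist1 g = ‖(g : Matrix n n ℂ) - 1‖ := rfl

/-- Reverse triangle inequality for `dist1`: `dist1 h ≤ dist1 g + dist1 (g·h)`. [folklore] -/
private theorem dist1_le_add_mul {G : Type*} [GaugeGroup G] (g h : G) : dist1 h ≤ dist1 g + dist1 (g * h) := by
  have := GaugeGroup.dist1_mul_le g⁻¹ (g * h)
  rw [inv_mul_cancel_left, GaugeGroup.dist1_inv] at this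
  exact this

/-- `‖gh·k − k‖ = ‖gh − 1‖`-type letter: `‖(x − 1)·g‖ = ‖x − 1‖` packaged for a product. [folklore] -/
private theorem norm_coe_mul_coe_sub (x g : Matrix.specialUnitaryGroup n ℂ) :
    ‖((x * g : Matrix.specialUnitaryGroup n ℂ) : Matrix n n ℂ) - (g : Matrix n n ℂ)‖ = dist1 x := by
  rw [Submonoid.coe_mul, show (x : Matrix n n ℂ) * (g : Matrix n n ℂ) - (g : Matrix n n ℂ) = ((x : Matrix n n ℂ) - 1) * (g : Matrix n n ℂ) by
    noncomm_ring, norm_mul_coe, dist1_eq]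

end SU

/-! ## §1 STAGE 1 — the global a-priori bound from the series logarithm -/

section Abstract

variable {n : Type*} [Fintype n] [DecidableEq n] [Nonempty n] {ι : Type*} [Fintype ι] [Nonempty ι]

omit [Fintype ι] [Nonempty ι] in
/-- Sizes of the members of the family `m_i = R_iW_iT⁻¹` (off) ∕ `R_iTW_iT⁻¹` (on): on-axis members are `(η+α)`-small, and an off-axis member
pins `|T − 1|` to within `η + α` of its own size. [cite: Balaban1987RG1, p.267] -/
theorem member_sizes (on : ι → Prop) (m R W : ι → Matrix.specialUnitaryGroup n ℂ) (T : Matrix.specialUnitaryGroup n ℂ) {η α : ℝ}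
    (hoff : ∀ i, ¬ on i → m i = R i * W i * T⁻¹) (hon : ∀ i, on i → m i = R i * T * W i * T⁻¹)
    (hR : ∀ i, dist1 (R i) ≤ η) (hW : ∀ i, dist1 (W i) ≤ α) :
    (∀ i, on i → dist1 (m i) ≤ η + α) ∧ (∀ i, ¬ on i → dist1 (m i) ≤ η + α + dist1 T) ∧
      (∀ i, ¬ on i → dist1 T ≤ η + α + dist1 (m i)) := by
  have hRW : ∀ i, dist1 (R i * W i) ≤ η + α := fun i => (GaugeGroup.dist1_mul_le (R i) (W i)).trans (add_le_add (hR i) (hW i))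
  refine ⟨fun i hi => ?_, fun i hi => ?_, fun i hi => ?_⟩
  · have e : R i * T * W i * T⁻¹ = R i * (T * W i * T⁻¹) := by simp only [mul_assoc]
    rw [hon i hi, e]
    have hc : dist1 (T * W i * T⁻¹) = dist1 (W i) := GaugeGroup.dist1_conj _ _
    exact (GaugeGroup.dist1_mul_le (R i) (T * W i * T⁻¹)).trans (add_le_add (hR i) (hc.le.trans (hW i)))
  · rw [hoff i hi]
    have hTi : dist1 T⁻¹ = dist1 T := GaugeGroup.dist1_inv T
    exact (GaugeGroup.dist1_mul_le (R i * W i) T⁻¹).trans (add_le_add (hRW i) hTi.le)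
  · have h1 : dist1 T⁻¹ ≤ dist1 (R i * W i) + dist1 (R i * W i * T⁻¹) := dist1_le_add_mul (R i * W i) T⁻¹
    have h2 : dist1 T⁻¹ = dist1 T := GaugeGroup.dist1_inv T
    have h3 := hRW i
    have h4 : m i = R i * W i * T⁻¹ := hoff i hi
    rw [← h4] at h1
    linarith

omit [Nonempty ι] in
/-- **THE GUARD HOLDS**: if it failed, `K = 1` and `T = R_S⁻¹κ` would be `(η + 2α)`-close to `1`, while a `δ_N`-large member must be off-axis and
forces `|T − 1| ≥ δ_N − η − α` — impossible for `3(η + α) + … < δ_N`. [cite: Balaban1987RG1, p.267] -/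
theorem guard_of_fibre_identity (on : ι → Prop) (m R W : ι → Matrix.specialUnitaryGroup n ℂ)
    (T RS K κ : Matrix.specialUnitaryGroup n ℂ) {η α : ℝ}
    (hoff : ∀ i, ¬ on i → m i = R i * W i * T⁻¹) (hon : ∀ i, on i → m i = R i * T * W i * T⁻¹)
    (hR : ∀ i, dist1 (R i) ≤ η) (hW : ∀ i, dist1 (W i) ≤ α) (hRS : dist1 RS ≤ η) (hκ : dist1 κ ≤ 2 * α)
    (hK : K * RS * T = κ) (hKns : ¬ (∀ i, dist1 (m i) < deltaSU n) → K = 1) (hnum : 3 * (η + α) < deltaSU n) :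
    ∀ i, dist1 (m i) < deltaSU n := by
  obtain ⟨hmon, hmoff, -⟩ := member_sizes on m R W T hoff hon hR hW
  by_contra hns
  have hK1 := hKns hns
  rw [hK1, one_mul] at hK
  have hT : T = RS⁻¹ * κ := by rw [← hK, inv_mul_cancel_left]
  have hyle : dist1 T ≤ η + 2 * α := by
    have hRi : dist1 RS⁻¹ = dist1 RS := GaugeGroup.dist1_inv RS
    rw [hT]; exact (GaugeGroup.dist1_mul_le RS⁻¹ κ).trans (add_le_add (hRi.le.trans hRS) hκ)
  push Not at hns
  obtain ⟨i, hi⟩ := hns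
  have hα : 0 ≤ α := (GaugeGroup.dist1_nonneg _).trans (hW i)
  have hη : 0 ≤ η := (GaugeGroup.dist1_nonneg _).trans (hR i)
  have hδ := deltaSU_pos (n := n)
  by_cases hio : on i
  · have := hmon i hio; linarith
  · have := hmoff i hio; linarith

/-- The mean of a family split along a decidable predicate: `|I|⁻¹Σ_i f_i + (1 − λ)X = |I|⁻¹Σ_i (f_i − [¬on i](−X))`, `λ = |on|∕|I|`.
[cite: Balaban1987RG1, (0.4) p.253 (bookkeeping)] -/
theorem mean_add_offWeight_smul {M : Type*} [AddCommGroup M] [Module ℂ M] (on : ι → Prop) [DecidablePred on] (f : ι → M) (X : M) :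
    ((Fintype.card ι : ℂ))⁻¹ • ∑ i, f i +
        ((1 : ℂ) - ((((Finset.univ.filter on).card : ℝ) / Fintype.card ι : ℝ) : ℂ)) • X =
      ((Fintype.card ι : ℂ))⁻¹ • ∑ i, (f i - if on i then 0 else -X) := by
  have hc0 : (Fintype.card ι : ℂ) ≠ 0 := Nat.cast_ne_zero.mpr Fintype.card_ne_zero
  have hcard := Finset.card_filter_add_card_filter_not (s := (Finset.univ : Finset ι)) on
  rw [Finset.card_univ] at hcard
  have hoffC : ((Finset.univ.filter fun i => ¬ on i).card : ℂ) =
      (Fintype.card ι : ℂ) * ((1 : ℂ) - ((((Finset.univ.filter on).card : ℝ) / Fintype.card ι : ℝ) : ℂ)) := by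
    have h1 : ((Finset.univ.filter on).card : ℂ) + ((Finset.univ.filter fun i => ¬ on i).card : ℂ) = Fintype.card ι := by
      exact_mod_cast hcard
    push_cast
    field_simp
    linear_combination h1
  rw [Finset.sum_sub_distrib, smul_sub, Finset.sum_ite, Finset.sum_const_zero, zero_add, Finset.sum_const, ← Nat.cast_smul_eq_nsmul ℂ,
    hoffC, smul_neg, smul_neg, smul_smul, ← mul_assoc, inv_mul_cancel₀ hc0, one_mul, sub_neg_eq_add]

omit [Fintype ι] [Nonempty ι] in
/-- **THE LOGARITHMS OF THE MEMBERS** on the guard, `|T − 1| ≤ 2/5`: `‖log m_i − [¬on i](−log T)‖ ≤ 2(η + α)` (off the axis by the Lipschitz bound of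
`MatrixLogLipschitz`, `log T⁻¹ = −log T`; on it by (26)). [cite: Balaban1987RG1, p.267] -/
theorem norm_log_member_le (on : ι → Prop) [DecidablePred on] (m R W : ι → Matrix.specialUnitaryGroup n ℂ)
    (T : Matrix.specialUnitaryGroup n ℂ) {η α : ℝ}
    (hoff : ∀ i, ¬ on i → m i = R i * W i * T⁻¹) (hon : ∀ i, on i → m i = R i * T * W i * T⁻¹)
    (hR : ∀ i, dist1 (R i) ≤ η) (hW : ∀ i, dist1 (W i) ≤ α) (hguard : ∀ i, dist1 (m i) < deltaSU n)
    (hT25 : ‖(T : Matrix n n ℂ) - 1‖ ≤ 2 / 5) (hsmall : η + α ≤ 1 / 6) (i : ι) :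
    ‖mlog (m i : Matrix n n ℂ) - (if on i then 0 else -mlog (T : Matrix n n ℂ))‖ ≤ 2 * (η + α) := by
  obtain ⟨hmon, -, -⟩ := member_sizes on m R W T hoff hon hR hW
  have hRW : dist1 (R i * W i) ≤ η + α := (GaugeGroup.dist1_mul_le (R i) (W i)).trans (add_le_add (hR i) (hW i))
  have hTinv25 : ‖((T⁻¹ : Matrix.specialUnitaryGroup n ℂ) : Matrix n n ℂ) - 1‖ ≤ 2 / 5 := by
    rw [← dist1_eq, GaugeGroup.dist1_inv, dist1_eq]; exact hT25
  by_cases hi : on i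
  · simp only [if_pos hi, sub_zero]
    have h1 : ‖(m i : Matrix n n ℂ) - 1‖ ≤ η + α := by rw [← dist1_eq]; exact hmon i hi
    exact (norm_mlog_le_two_mul (h1.trans (by linarith))).trans (by linarith)
  · simp only [if_neg hi]
    rw [← mlog_eq_neg_of_mul_eq_one_of_le (coe_mul_inv T) hT25]
    have h1 : ‖(m i : Matrix n n ℂ) - 1‖ ≤ 2 / 5 := by rw [← dist1_eq]; linarith [lt_third_of_lt_deltaSU (hguard i)]
    refine (norm_mlog_sub_mlog_le (by norm_num) h1 hTinv25).trans ?_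
    have h0 : 0 ≤ η + α := (GaugeGroup.dist1_nonneg _).trans hRW
    rw [hoff i hi, norm_coe_mul_coe_sub, div_le_iff₀ (by norm_num)]
    linarith

/-- **STAGE 1 (GLOBAL).**  With `K·R_S·T = κ` on the guard (`K = exp[mean log m]`), `|R_S − 1| ≤ η`, `|κ − 1| ≤ 2α`, an off-axis index and
`λ = |on|∕|I| > 0`: `|T − 1| ≤ 12(η + α)∕λ`.  (`mean log m = −(1−λ)log T + O(η+α)`, `exp(mean log m) = κT⁻¹R_S⁻¹ = e^{−log T} + O(η+α)`, take logarithms.)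
[cite: Balaban1987RG1, p.267] -/
theorem stage1_dist1_le (on : ι → Prop) [DecidablePred on] (m R W : ι → Matrix.specialUnitaryGroup n ℂ)
    (T RS K κ : Matrix.specialUnitaryGroup n ℂ) {η α : ℝ}
    (hoff : ∀ i, ¬ on i → m i = R i * W i * T⁻¹) (hon : ∀ i, on i → m i = R i * T * W i * T⁻¹)
    (hR : ∀ i, dist1 (R i) ≤ η) (hW : ∀ i, dist1 (W i) ≤ α) (hRS : dist1 RS ≤ η) (hκ : dist1 κ ≤ 2 * α)
    (hK : K * RS * T = κ) (hguard : ∀ i, dist1 (m i) < deltaSU n)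
    (hKsm : (K : Matrix n n ℂ) = eml fun i => (m i : Matrix n n ℂ))
    {i₀ : ι} (hi₀ : ¬ on i₀) (hpos : 0 < (Finset.univ.filter on).card) (hsmall : η + α ≤ 1 / 45) :
    dist1 T ≤ 12 * (η + α) / (((Finset.univ.filter on).card : ℝ) / Fintype.card ι) := by
  obtain ⟨hmon, -, hmoff'⟩ := member_sizes on m R W T hoff hon hR hW
  set lam : ℝ := ((Finset.univ.filter on).card : ℝ) / Fintype.card ι with hlam
  have hcard : (0 : ℝ) < Fintype.card ι := Nat.cast_pos.mpr Fintype.card_pos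
  have hlam0 : 0 < lam := div_pos (Nat.cast_pos.mpr hpos) hcard
  have hη : 0 ≤ η := (GaugeGroup.dist1_nonneg _).trans hRS
  have hα : 0 ≤ α := (GaugeGroup.dist1_nonneg _).trans (hW i₀)
  -- `|T − 1| ≤ 1/3 + η + α ≤ 2/5 − …`
  have hT25 : ‖(T : Matrix n n ℂ) - 1‖ ≤ 2 / 5 - 2 * (η + α) := by
    have := hmoff' i₀ hi₀; have := lt_third_of_lt_deltaSU (hguard i₀); rw [← dist1_eq]; linarith
  have hT25' : ‖(T : Matrix n n ℂ) - 1‖ ≤ 2 / 5 := hT25.trans (by linarith)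
  have hTinv25 : ‖((T⁻¹ : Matrix.specialUnitaryGroup n ℂ) : Matrix n n ℂ) - 1‖ ≤ 2 / 5 - 2 * (η + α) := by
    rw [← dist1_eq, GaugeGroup.dist1_inv, dist1_eq]; exact hT25
  set X : Matrix n n ℂ := mlog (T : Matrix n n ℂ) with hX
  have hXinv : mlog (((T⁻¹ : Matrix.specialUnitaryGroup n ℂ) : Matrix n n ℂ)) = -X := mlog_eq_neg_of_mul_eq_one_of_le (coe_mul_inv T) hT25'
  have hXn : ‖X‖ ≤ 2 / 3 := norm_mlog_le_two_thirds hT25'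
  -- the mean of the logarithms
  set mbar : Matrix n n ℂ := ((Fintype.card ι : ℂ))⁻¹ • ∑ i, mlog (m i : Matrix n n ℂ) with hmbar
  have hmean_le : ‖mbar + ((1 : ℂ) - (lam : ℂ)) • X‖ ≤ 2 * (η + α) := by
    rw [hmbar, hlam, mean_add_offWeight_smul on, norm_smul, norm_inv, Complex.norm_natCast, inv_mul_le_iff₀ hcard]
    calc ‖∑ i, (mlog (m i : Matrix n n ℂ) - if on i then 0 else -X)‖
        ≤ ∑ i, ‖mlog (m i : Matrix n n ℂ) - if on i then 0 else -X‖ := norm_sum_le _ _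
      _ ≤ ∑ _i : ι, 2 * (η + α) :=
          Finset.sum_le_sum fun i _ => norm_log_member_le on m R W T hoff hon hR hW hguard hT25' (by linarith) i
      _ = Fintype.card ι * (2 * (η + α)) := by rw [Finset.sum_const, Finset.card_univ, nsmul_eq_mul]
  -- the identity on the guard: `exp m̄ = κ T⁻¹ R_S⁻¹`, within `2α + η` of `T⁻¹ = exp(−X)`
  have hKeml : (K : Matrix n n ℂ) = exp mbar := by rw [hKsm, eml_eq_exp]
  have hKeq : K = κ * (T⁻¹ * RS⁻¹) := by rw [← hK]; simp [mul_assoc]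
  have hdiff : ‖exp mbar - ((T⁻¹ : Matrix.specialUnitaryGroup n ℂ) : Matrix n n ℂ)‖ ≤ 2 * α + η := by
    rw [← hKeml, hKeq]
    have e : ((κ * (T⁻¹ * RS⁻¹) : Matrix.specialUnitaryGroup n ℂ) : Matrix n n ℂ) - ((T⁻¹ : Matrix.specialUnitaryGroup n ℂ) : Matrix n n ℂ) =
        (((κ * (T⁻¹ * RS⁻¹) : Matrix.specialUnitaryGroup n ℂ) : Matrix n n ℂ) - ((T⁻¹ * RS⁻¹ : Matrix.specialUnitaryGroup n ℂ) : Matrix n n ℂ)) +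
          (((T⁻¹ * RS⁻¹ : Matrix.specialUnitaryGroup n ℂ) : Matrix n n ℂ) - ((T⁻¹ : Matrix.specialUnitaryGroup n ℂ) : Matrix n n ℂ)) := by abel
    rw [e]
    refine (norm_add_le _ _).trans (add_le_add ?_ ?_)
    · rw [norm_coe_mul_coe_sub]; exact hκ
    · rw [Submonoid.coe_mul, show ((T⁻¹ : Matrix.specialUnitaryGroup n ℂ) : Matrix n n ℂ) * ((RS⁻¹ : Matrix.specialUnitaryGroup n ℂ) : Matrix n n ℂ) -
          ((T⁻¹ : Matrix.specialUnitaryGroup n ℂ) : Matrix n n ℂ) =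
          ((T⁻¹ : Matrix.specialUnitaryGroup n ℂ) : Matrix n n ℂ) * (((RS⁻¹ : Matrix.specialUnitaryGroup n ℂ) : Matrix n n ℂ) - 1) by noncomm_ring,
        norm_coe_mul, ← dist1_eq, GaugeGroup.dist1_inv]
      exact hRS
  have hTexp : ((T⁻¹ : Matrix.specialUnitaryGroup n ℂ) : Matrix n n ℂ) = exp (-X) := by
    rw [← hXinv, exp_mlog (hTinv25.trans_lt (by linarith))]
  -- take logarithms
  have hmbar_lt : ‖mbar‖ < Real.log 2 :=
    norm_meanLog_lt fun i => norm_mlog_lt_log_two (by rw [← dist1_eq]; exact (lt_third_of_lt_deltaSU (hguard i)).le)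
  have hexpm : ‖exp mbar - 1‖ ≤ 2 / 5 := by
    have : ‖exp mbar - 1‖ ≤ ‖exp mbar - ((T⁻¹ : Matrix.specialUnitaryGroup n ℂ) : Matrix n n ℂ)‖ +
        ‖((T⁻¹ : Matrix.specialUnitaryGroup n ℂ) : Matrix n n ℂ) - 1‖ := by
      rw [show exp mbar - 1 = (exp mbar - ((T⁻¹ : Matrix.specialUnitaryGroup n ℂ) : Matrix n n ℂ)) +
        (((T⁻¹ : Matrix.specialUnitaryGroup n ℂ) : Matrix n n ℂ) - 1) by abel]; exact norm_add_le _ _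
    linarith
  have hlog := norm_mlog_sub_mlog_le (r := 2 / 5) (by norm_num) hexpm (hTinv25.trans (by linarith))
  have hlog2 : ‖-X‖ < Real.log 2 := by rw [norm_neg]; have := Real.log_two_gt_d9; linarith
  rw [B7BlockAvgLog.mlog_exp hmbar_lt, hTexp, B7BlockAvgLog.mlog_exp hlog2, sub_neg_eq_add, ← hTexp] at hlog
  have hmX : ‖mbar + X‖ ≤ 2 * (2 * α + η) := by
    refine hlog.trans ?_; rw [div_le_iff₀ (by norm_num)]; linarith
  -- `λX = (m̄ + X) − (m̄ + (1−λ)X)`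
  have hlamX : lam * ‖X‖ ≤ 2 * (2 * α + η) + 2 * (η + α) := by
    have e : ((lam : ℂ)) • X = (mbar + X) - (mbar + ((1 : ℂ) - (lam : ℂ)) • X) := by
      rw [sub_smul, one_smul]; abel
    have : ‖((lam : ℂ)) • X‖ ≤ 2 * (2 * α + η) + 2 * (η + α) := by rw [e]; exact (norm_sub_le _ _).trans (add_le_add hmX hmean_le)
    rwa [norm_smul, Complex.norm_real, Real.norm_of_nonneg hlam0.le] at this
  have hXle : ‖X‖ ≤ (6 * (η + α)) / lam := by
    rw [le_div_iff₀ hlam0]; nlinarith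
  -- back to `T`: `‖T − 1‖ ≤ 2‖log T‖`
  have hT1 : ‖(T : Matrix n n ℂ) - 1‖ < 1 := hT25'.trans_lt (by norm_num)
  have := norm_sub_one_le_two_mul_norm_mlog_of_le hT1 (hXn.trans (by norm_num))
  rw [← dist1_eq, ← hX] at this
  calc dist1 T ≤ 2 * ‖X‖ := this
    _ ≤ 2 * ((6 * (η + α)) / lam) := by linarith
    _ = 12 * (η + α) / lam := by ring

/-! ## §2 STAGE 2 — the perturbative bound from the analytic-mean increment lemma (the `α`-terms cancel) -/

/-- The mean of an off-axis constant: `|I|⁻¹Σ_i [¬on i]Z = (1 − λ)Z`. [cite: Balaban1987RG1, (0.4) p.253 (bookkeeping)] -/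
theorem mean_ite_off {M : Type*} [AddCommGroup M] [Module ℂ M] (on : ι → Prop) [DecidablePred on] (Z : M) :
    ((Fintype.card ι : ℂ))⁻¹ • ∑ i, (if on i then (0 : M) else Z) =
      ((1 : ℂ) - ((((Finset.univ.filter on).card : ℝ) / Fintype.card ι : ℝ) : ℂ)) • Z := by
  have hc0 : (Fintype.card ι : ℂ) ≠ 0 := Nat.cast_ne_zero.mpr Fintype.card_ne_zero
  have hcard := Finset.card_filter_add_card_filter_not (s := (Finset.univ : Finset ι)) on
  rw [Finset.card_univ] at hcard
  have hoffC : ((Finset.univ.filter fun i => ¬ on i).card : ℂ) =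
      (Fintype.card ι : ℂ) * ((1 : ℂ) - ((((Finset.univ.filter on).card : ℝ) / Fintype.card ι : ℝ) : ℂ)) := by
    have h1 : ((Finset.univ.filter on).card : ℂ) + ((Finset.univ.filter fun i => ¬ on i).card : ℂ) = Fintype.card ι := by
      exact_mod_cast hcard
    push_cast
    field_simp
    linear_combination h1
  rw [Finset.sum_ite, Finset.sum_const_zero, zero_add, Finset.sum_const, ← Nat.cast_smul_eq_nsmul ℂ, hoffC, smul_smul, ← mul_assoc,
    inv_mul_cancel₀ hc0, one_mul]

/-- **STAGE 2 (PERTURBATIVE).**  On the guard, with `K = exp[mean log m]`, `κ = exp[mean log W]` (`|W_i − 1| ≤ α ≤ 1/24`), `K·R_S·T = κ` and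
`|T − 1| + η ≤ 1/24`: `λ|T−1| ≤ |T−1|·(148α + 98η + 48|T−1|) + η(2 + 146α + 48η)` — the background terms cancel to first order
(`BlockAveragingEMLLinearisedBackground.norm_eml_add_sub_sub_mean_le` at the family `W`). [cite: Balaban1987RG1, p.267] -/
theorem stage2_dist1_le (on : ι → Prop) [DecidablePred on] (m R W : ι → Matrix.specialUnitaryGroup n ℂ)
    (T RS K κ : Matrix.specialUnitaryGroup n ℂ) {η α : ℝ}
    (hoff : ∀ i, ¬ on i → m i = R i * W i * T⁻¹) (hon : ∀ i, on i → m i = R i * T * W i * T⁻¹)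
    (hR : ∀ i, dist1 (R i) ≤ η) (hW : ∀ i, dist1 (W i) ≤ α) (hRS : dist1 RS ≤ η) (hκ : dist1 κ ≤ 2 * α)
    (hK : K * RS * T = κ) (hKsm : (K : Matrix n n ℂ) = eml fun i => (m i : Matrix n n ℂ))
    (hκsm : (κ : Matrix n n ℂ) = eml fun i => (W i : Matrix n n ℂ)) (hα24 : α ≤ 1 / 24) (hv : dist1 T + η ≤ 1 / 24) :
    (((Finset.univ.filter on).card : ℝ) / Fintype.card ι) * dist1 T ≤
      dist1 T * (148 * α + 98 * η + 48 * dist1 T) + η * (2 + 146 * α + 48 * η) := by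
  have hi := Classical.arbitrary ι
  have hη : 0 ≤ η := (GaugeGroup.dist1_nonneg _).trans hRS
  have hα : 0 ≤ α := (GaugeGroup.dist1_nonneg _).trans (hW hi)
  set lam : ℝ := ((Finset.univ.filter on).card : ℝ) / Fintype.card ι with hlam
  have hcard : (0 : ℝ) < Fintype.card ι := Nat.cast_pos.mpr Fintype.card_pos
  have hlam0 : 0 ≤ lam := div_nonneg (Nat.cast_nonneg _) hcard.le
  have hlam1 : lam ≤ 1 := by
    rw [hlam, div_le_one hcard]; exact_mod_cast (Finset.card_filter_le _ _).trans (Finset.card_univ (α := ι)).le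
  set y : ℝ := dist1 T with hy
  have hy0 : 0 ≤ y := GaugeGroup.dist1_nonneg _
  -- matrices
  set t : Matrix n n ℂ := (T : Matrix n n ℂ)
  set ti : Matrix n n ℂ := ((T⁻¹ : Matrix.specialUnitaryGroup n ℂ) : Matrix n n ℂ) with hti
  have hti_y : ‖ti - 1‖ = y := by rw [hy, ← GaugeGroup.dist1_inv, dist1_eq]
  have ht_y : ‖t - 1‖ = y := by rw [hy, dist1_eq]
  have htti : t * ti = 1 := coe_mul_inv T
  set Wm : ι → Matrix n n ℂ := fun i => (W i : Matrix n n ℂ) with hWm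
  set V : ι → Matrix n n ℂ := fun i => (m i : Matrix n n ℂ) - (W i : Matrix n n ℂ) with hV
  have hWα : ∀ i, ‖(W i : Matrix n n ℂ) - 1‖ ≤ α := fun i => by rw [← dist1_eq]; exact hW i
  -- the increments
  set ρ' : ι → Matrix n n ℂ := fun i => V i - (if on i then 0 else (ti - 1)) with hρ'
  have hVρ : ∀ i, ‖V i‖ ≤ y + η ∧ ‖ρ' i‖ ≤ η + 2 * (η + α) * y := by
    intro i
    by_cases hio : on i
    · have e1 : V i = (((R i : Matrix.specialUnitaryGroup n ℂ) : Matrix n n ℂ) - 1) * ((T * W i * T⁻¹ : Matrix.specialUnitaryGroup n ℂ) : Matrix n n ℂ) +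
          ((t - 1) * ((W i : Matrix n n ℂ) - 1) * ti + ((W i : Matrix n n ℂ) - 1) * (ti - 1)) := by
        simp only [hV, hon i hio, Submonoid.coe_mul]
        have := htti
        -- `RTWT⁻¹ − W = (R−1)TWT⁻¹ + (TWT⁻¹ − W)` and `TWT⁻¹ − W = (T−1)(W−1)T⁻¹ + (W−1)(T⁻¹−1)` using `TT⁻¹ = 1`
        have e : t * (W i : Matrix n n ℂ) * ti - (W i : Matrix n n ℂ) =
            (t - 1) * ((W i : Matrix n n ℂ) - 1) * ti + ((W i : Matrix n n ℂ) - 1) * (ti - 1) := by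
          have : (t - 1) * ((W i : Matrix n n ℂ) - 1) * ti + ((W i : Matrix n n ℂ) - 1) * (ti - 1) =
              t * (W i : Matrix n n ℂ) * ti - t * ti - (W i : Matrix n n ℂ) + 1 := by noncomm_ring
          rw [this, htti]; noncomm_ring
        rw [← e]; noncomm_ring
      have hb1 : ‖V i‖ ≤ η + 2 * α * y := by
        rw [e1]
        refine (norm_add_le _ _).trans (add_le_add ?_ ((norm_add_le _ _).trans ?_))
        · rw [norm_mul_coe, ← dist1_eq]; exact hR i
        · calc ‖(t - 1) * ((W i : Matrix n n ℂ) - 1) * ti‖ + ‖((W i : Matrix n n ℂ) - 1) * (ti - 1)‖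
              ≤ ‖t - 1‖ * ‖(W i : Matrix n n ℂ) - 1‖ + ‖(W i : Matrix n n ℂ) - 1‖ * ‖ti - 1‖ := by
                refine add_le_add ?_ (norm_mul_le _ _)
                rw [hti, norm_mul_coe]; exact norm_mul_le _ _
            _ ≤ y * α + α * y := by
                rw [ht_y, hti_y]
                exact add_le_add (mul_le_mul_of_nonneg_left (hWα i) hy0) (mul_le_mul_of_nonneg_right (hWα i) hy0)
            _ = 2 * α * y := by ring
      have hρ'eq : ρ' i = V i := by simp only [hρ', if_pos hio, sub_zero]
      refine ⟨hb1.trans (by nlinarith), ?_⟩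
      rw [hρ'eq]; refine hb1.trans ?_; nlinarith
    · have e1 : V i = ((R i * W i : Matrix.specialUnitaryGroup n ℂ) : Matrix n n ℂ) * (ti - 1) +
          (((R i : Matrix.specialUnitaryGroup n ℂ) : Matrix n n ℂ) - 1) * (W i : Matrix n n ℂ) := by
        simp only [hV, hoff i hio, Submonoid.coe_mul, hti]; noncomm_ring
      have e2 : ρ' i = (((R i * W i : Matrix.specialUnitaryGroup n ℂ) : Matrix n n ℂ) - 1) * (ti - 1) +
          (((R i : Matrix.specialUnitaryGroup n ℂ) : Matrix n n ℂ) - 1) * (W i : Matrix n n ℂ) := by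
        simp only [hρ', if_neg hio, e1]; noncomm_ring
      have hRW : ‖((R i * W i : Matrix.specialUnitaryGroup n ℂ) : Matrix n n ℂ) - 1‖ ≤ η + α := by
        rw [← dist1_eq]; exact (GaugeGroup.dist1_mul_le (R i) (W i)).trans (add_le_add (hR i) (hW i))
      constructor
      · rw [e1]
        refine (norm_add_le _ _).trans (add_le_add ?_ ?_)
        · rw [norm_coe_mul, hti_y]
        · rw [norm_mul_coe, ← dist1_eq]; exact hR i
      · rw [e2]
        refine (norm_add_le _ _).trans ?_
        have h1 : ‖(((R i * W i : Matrix.specialUnitaryGroup n ℂ) : Matrix n n ℂ) - 1) * (ti - 1)‖ ≤ (η + α) * y :=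
          (norm_mul_le _ _).trans (by rw [hti_y]; exact mul_le_mul_of_nonneg_right hRW hy0)
        have h2 : ‖(((R i : Matrix.specialUnitaryGroup n ℂ) : Matrix n n ℂ) - 1) * (W i : Matrix n n ℂ)‖ ≤ η := by
          rw [norm_mul_coe, ← dist1_eq]; exact hR i
        nlinarith
  -- the analytic-mean increment lemma at the background family
  have hU : ‖Wm - 1‖ ≤ 1 / 24 := by
    refine (pi_norm_le_iff_of_nonneg (by norm_num)).2 fun i => ?_
    simp only [hWm, Pi.sub_apply, Pi.one_apply]; exact (hWα i).trans hα24
  have hVn : ‖V‖ ≤ y + η := (pi_norm_le_iff_of_nonneg (by positivity)).2 fun i => (hVρ i).1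
  have hrem := BlockAveragingEMLLinearisedBackground.norm_eml_add_sub_sub_mean_le hU (hVn.trans hv)
  have hWV : Wm + V = fun i => (m i : Matrix n n ℂ) := by funext i; simp [hWm, hV]
  rw [hWV, ← hKsm, show (eml Wm) = (κ : Matrix n n ℂ) from hκsm.symm] at hrem
  have hUα : ‖Wm - 1‖ ≤ α := (pi_norm_le_iff_of_nonneg hα).2 fun i => by simp only [hWm, Pi.sub_apply, Pi.one_apply]; exact hWα i
  have hrem' : ‖(K : Matrix n n ℂ) - (κ : Matrix n n ℂ) - ((Fintype.card ι : ℂ))⁻¹ • ∑ i, V i‖ ≤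
      48 * (y + η) ^ 2 + 144 * (y + η) * α := by
    refine hrem.trans ?_
    have h1 : ‖V‖ ^ 2 ≤ (y + η) ^ 2 := pow_le_pow_left₀ (norm_nonneg _) hVn 2
    nlinarith [norm_nonneg V, norm_nonneg (Wm - 1), mul_le_mul hVn hUα (norm_nonneg _) (by positivity)]
  -- the mean of the increments
  have hmean : ((Fintype.card ι : ℂ))⁻¹ • ∑ i, V i = ((1 : ℂ) - (lam : ℂ)) • (ti - 1) + ((Fintype.card ι : ℂ))⁻¹ • ∑ i, ρ' i := by
    have : ∑ i, V i = ∑ i, (if on i then (0 : Matrix n n ℂ) else (ti - 1)) + ∑ i, ρ' i := by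
      rw [← Finset.sum_add_distrib]; exact Finset.sum_congr rfl fun i _ => by simp only [hρ']; abel
    rw [this, smul_add, mean_ite_off on]
  have hρ2 : ‖((Fintype.card ι : ℂ))⁻¹ • ∑ i, ρ' i‖ ≤ η + 2 * (η + α) * y := by
    rw [norm_smul, norm_inv, Complex.norm_natCast, inv_mul_le_iff₀ hcard]
    calc ‖∑ i, ρ' i‖ ≤ ∑ i, ‖ρ' i‖ := norm_sum_le _ _
      _ ≤ ∑ _i : ι, (η + 2 * (η + α) * y) := Finset.sum_le_sum fun i _ => (hVρ i).2
      _ = Fintype.card ι * (η + 2 * (η + α) * y) := by rw [Finset.sum_const, Finset.card_univ, nsmul_eq_mul]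
  -- the identity: `K − κ = κ(T⁻¹R_S⁻¹ − 1)`
  set rsi : Matrix n n ℂ := ((RS⁻¹ : Matrix.specialUnitaryGroup n ℂ) : Matrix n n ℂ) with hrsi
  have hKκ : (K : Matrix n n ℂ) - (κ : Matrix n n ℂ) = (κ : Matrix n n ℂ) * (ti * rsi - 1) := by
    have hKeq : K = κ * (T⁻¹ * RS⁻¹) := by rw [← hK]; simp [mul_assoc]
    rw [hKeq, Submonoid.coe_mul, Submonoid.coe_mul]; noncomm_ring
  -- assemble: `−λ(T⁻¹ − 1) = (κ−1)(T⁻¹R_S⁻¹ − 1) + T⁻¹(R_S⁻¹ − 1) − Rem − ρ₂`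
  set Rem : Matrix n n ℂ := (K : Matrix n n ℂ) - (κ : Matrix n n ℂ) - ((Fintype.card ι : ℂ))⁻¹ • ∑ i, V i with hRem
  set ρ₂ : Matrix n n ℂ := ((Fintype.card ι : ℂ))⁻¹ • ∑ i, ρ' i with hρ₂
  have key : ((lam : ℂ)) • (ti - 1) = -(((κ : Matrix n n ℂ) - 1) * (ti * rsi - 1)) - ti * (rsi - 1) + Rem + ρ₂ := by
    have h1 : Rem = (κ : Matrix n n ℂ) * (ti * rsi - 1) - (((1 : ℂ) - (lam : ℂ)) • (ti - 1) + ρ₂) := by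
      rw [hRem, hKκ, hmean]
    rw [h1, sub_smul, one_smul]
    noncomm_ring
  have hnorm : lam * y ≤ 2 * α * (y + η) + η + (48 * (y + η) ^ 2 + 144 * (y + η) * α) + (η + 2 * (η + α) * y) := by
    have hn : ‖((lam : ℂ)) • (ti - 1)‖ = lam * y := by rw [norm_smul, Complex.norm_real, Real.norm_of_nonneg hlam0, hti_y]
    rw [← hn, key]
    refine (norm_add_le _ _).trans (add_le_add ((norm_add_le _ _).trans (add_le_add ((norm_sub_le _ _).trans (add_le_add ?_ ?_)) hrem')) hρ2)
    · rw [norm_neg]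
      refine (norm_mul_le _ _).trans ?_
      have h1 : ‖(κ : Matrix n n ℂ) - 1‖ ≤ 2 * α := by rw [← dist1_eq]; exact hκ
      have h2 : ‖ti * rsi - 1‖ ≤ y + η := by
        rw [hti, hrsi, ← Submonoid.coe_mul, ← dist1_eq]
        exact (GaugeGroup.dist1_mul_le T⁻¹ RS⁻¹).trans (add_le_add (by rw [GaugeGroup.dist1_inv]) (by rw [GaugeGroup.dist1_inv]; exact hRS))
      exact mul_le_mul h1 h2 (norm_nonneg _) (by positivity)
    · rw [hti, norm_coe_mul, hrsi, ← dist1_eq, GaugeGroup.dist1_inv]; exact hRS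
  nlinarith

omit [Nonempty ι] in
/-- **THE RIDER, ABSTRACT FORM**: under the structure of §1–§2 and the numerics `1640(η + α) ≤ λ²`, `13(η + α) < λδ_N` (`λ = |on|∕|I|`, an off-axis index
exists): `|T − 1| ≤ 5η∕λ`. [cite: Balaban1987RG1, p.267] -/
theorem dist1_le_of_fibre_identity (on : ι → Prop) [DecidablePred on] (m R W : ι → Matrix.specialUnitaryGroup n ℂ)
    (T RS K κ : Matrix.specialUnitaryGroup n ℂ) {η α : ℝ}
    (hoff : ∀ i, ¬ on i → m i = R i * W i * T⁻¹) (hon : ∀ i, on i → m i = R i * T * W i * T⁻¹)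
    (hR : ∀ i, dist1 (R i) ≤ η) (hW : ∀ i, dist1 (W i) ≤ α) (hRS : dist1 RS ≤ η) (hκ : dist1 κ ≤ 2 * α)
    (hK : K * RS * T = κ)
    (hKsm : (∀ i, dist1 (m i) < deltaSU n) → (K : Matrix n n ℂ) = eml fun i => (m i : Matrix n n ℂ))
    (hKns : ¬ (∀ i, dist1 (m i) < deltaSU n) → K = 1)
    (hκsm : (κ : Matrix n n ℂ) = eml fun i => (W i : Matrix n n ℂ))
    {i₀ : ι} (hi₀ : ¬ on i₀) (hpos : 0 < (Finset.univ.filter on).card)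
    (h1 : 1640 * (η + α) ≤ (((Finset.univ.filter on).card : ℝ) / Fintype.card ι) ^ 2)
    (h2 : 13 * (η + α) < ((Finset.univ.filter on).card : ℝ) / Fintype.card ι * deltaSU n) :
    dist1 T ≤ 5 * η / (((Finset.univ.filter on).card : ℝ) / Fintype.card ι) := by
  set lam : ℝ := ((Finset.univ.filter on).card : ℝ) / Fintype.card ι with hlam
  haveI : Nonempty ι := ⟨i₀⟩
  have hcard : (0 : ℝ) < Fintype.card ι := Nat.cast_pos.mpr (Fintype.card_pos_iff.mpr ⟨i₀⟩)
  have hlam0 : 0 < lam := div_pos (Nat.cast_pos.mpr hpos) hcard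
  have hlam1 : lam ≤ 1 := by
    rw [hlam, div_le_one hcard]; exact_mod_cast (Finset.card_filter_le _ _).trans (Finset.card_univ (α := ι)).le
  have hη : 0 ≤ η := (GaugeGroup.dist1_nonneg _).trans hRS
  have hα : 0 ≤ α := (GaugeGroup.dist1_nonneg _).trans (hW i₀)
  have hδ := deltaSU_pos (n := n)
  have hsum : η + α ≤ lam ^ 2 / 1640 := by rw [le_div_iff₀ (by norm_num)]; linarith
  have hsum1 : η + α ≤ 1 / 1640 := hsum.trans (by rw [div_le_div_iff_of_pos_right (by norm_num)]; nlinarith)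
  have hguard : ∀ i, dist1 (m i) < deltaSU n :=
    guard_of_fibre_identity on m R W T RS K κ hoff hon hR hW hRS hκ hK hKns (by nlinarith)
  have hy₁ := stage1_dist1_le on m R W T RS K κ hoff hon hR hW hRS hκ hK hguard (hKsm hguard) hi₀ hpos (by linarith)
  rw [← hlam] at hy₁
  set y : ℝ := dist1 T with hy
  have hy0 : 0 ≤ y := GaugeGroup.dist1_nonneg _
  -- `y ≤ 12(η+α)/λ ≤ 12λ/1640`
  have hylam : lam * y ≤ 12 * (η + α) := by
    have h' := hy₁
    rw [le_div_iff₀ hlam0] at h'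
    linarith
  have hysmall : y ≤ 12 / 1640 := by
    have : lam * y ≤ 12 * (lam ^ 2 / 1640) := hylam.trans (by linarith)
    have : y ≤ 12 * lam / 1640 := by
      rw [le_div_iff₀ (by norm_num)]; nlinarith
    nlinarith
  have hst2 := stage2_dist1_le on m R W T RS K κ hoff hon hR hW hRS hκ hK (hKsm hguard) hκsm (by linarith) (by linarith)
  rw [← hlam, ← hy] at hst2
  -- `λy ≤ y(148α + 98η + 48y) + η(2 + 146α + 48η)`, and the bracket is `≤ λ/2`
  have hbr : 148 * α + 98 * η + 48 * y ≤ lam / 2 := by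
    have h48 : lam * (48 * y) ≤ 576 * (η + α) := by nlinarith
    -- `148(η+α) + 576(η+α)/λ ≤ λ/2` from `1640(η+α) ≤ λ²`
    have : lam * (148 * α + 98 * η + 48 * y) ≤ lam * (lam / 2) := by nlinarith
    exact le_of_mul_le_mul_left this hlam0
  have hC : η * (2 + 146 * α + 48 * η) ≤ (5 / 2) * η := by nlinarith
  have : lam * y ≤ y * (lam / 2) + (5 / 2) * η := hst2.trans (by nlinarith)
  rw [le_div_iff₀ hlam0]
  nlinarith

end Abstract

/-! ## §3 THE RIDER AT THE AVERAGING (0.4) WITH `exp[mean log]` ON `SU(N)` -/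

section Concrete

open T4Continuum BlockAveraging AveragingRT B10Eq47AxialChi BlockAveragingEMLLinearisedBackground B12B0LoopStructure267
open B12SmallFieldDomain259 (b0)

variable {n : Type*} [Fintype n] [DecidableEq n] [Nonempty n] {P : Params} {j : ℕ}

/-- `dist1 (V_b⁻¹U_b) = ‖U_bV_b⁻¹ − 1‖` (= `‖pertVar V U b‖`). [cite: Balaban1985Variational, (15) p.280] -/
theorem dist1_inv_mul_eq_norm_pertVar (V U : GaugeField P j (Matrix.specialUnitaryGroup n ℂ)) (b : PBond P j) :
    dist1 ((V b)⁻¹ * U b) = ‖pertVar V U b‖ := by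
  have h : (V b)⁻¹ * U b = (V b)⁻¹ * (U b * (V b)⁻¹) * (V b)⁻¹⁻¹ := by group
  rw [h, GaugeGroup.dist1_conj, pertVar, dist1_eq]

/-- **[Balaban1987RG1] p. 266–267, THE NONLINEAR RIDER AT THE (0.4) AVERAGING.**  Let `c` be a coarse bond, `V` a configuration whose (0.4) loop
variables at `c` are `α`-small, and `U` a configuration with THE SAME AVERAGE AT `c`, `M(U)(c) = M(V)(c)` (`M = avgFun expMeanLogSU`), whose left
fluctuation `U_bV_b⁻¹ − 1` is `ε`-small at every bond other than the distinguished bonds `b₀(c′)`.  If `1640(2ℓε + α) ≤ λ²` and `13(2ℓε + α) < λδ_N`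
(`ℓ = (d+2)L`, `λ = |on-axis indices|∕|Idx|`, `d ≥ 2`), then the fluctuation at `b₀(c)` is `O(ε)`: `‖U(b₀(c))V(b₀(c))⁻¹ − 1‖ ≤ 10ℓε∕λ`.
[cite: Balaban1987RG1, (2.9) p.266 and p.267] -/
theorem norm_pertVar_b0_le (hj : j + 1 ≤ P.m + P.K) (hd : 2 ≤ P.d) (U V : GaugeField P j (Matrix.specialUnitaryGroup n ℂ))
    (c : PBond P (j + 1)) {ε α : ℝ} (hε : 0 ≤ ε)
    (hM : avgFun (expMeanLogSU (n := n)) U c = avgFun (expMeanLogSU (n := n)) V c)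
    (hF : ∀ b : PBond P j, (∀ c' : PBond P (j + 1), b ≠ b0 c') → ‖pertVar V U b‖ ≤ ε)
    (hW : ∀ i, dist1 (loopHol V c i) ≤ α)
    (h1 : 1640 * (2 * ((((P.d + 2) * P.L : ℕ) : ℝ) * ε) + α) ≤
      (((Finset.univ.filter fun i : Idx P => ∀ ν, ν ≠ c.dir → (i.1 ν : ℕ) = (P.L - 1) / 2).card : ℝ) / Fintype.card (Idx P)) ^ 2)
    (h2 : 13 * (2 * ((((P.d + 2) * P.L : ℕ) : ℝ) * ε) + α) <
      ((Finset.univ.filter fun i : Idx P => ∀ ν, ν ≠ c.dir → (i.1 ν : ℕ) = (P.L - 1) / 2).card : ℝ) / Fintype.card (Idx P) * deltaSU n) :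
    ‖pertVar V U (b0 c)‖ ≤ 10 * ((((P.d + 2) * P.L : ℕ) : ℝ) * ε) /
      (((Finset.univ.filter fun i : Idx P => ∀ ν, ν ≠ c.dir → (i.1 ν : ℕ) = (P.L - 1) / 2).card : ℝ) / Fintype.card (Idx P)) := by
  classical
  -- letters
  set ℓ : ℝ := (((P.d + 2) * P.L : ℕ) : ℝ) with hℓ
  set onAx : Idx P → Prop := fun i => ∀ ν, ν ≠ c.dir → (i.1 ν : ℕ) = (P.L - 1) / 2 with hon_def
  set lam : ℝ := ((Finset.univ.filter onAx).card : ℝ) / Fintype.card (Idx P) with hlam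
  have hℓ0 : 0 ≤ ℓ := Nat.cast_nonneg _
  have hcardI : (0 : ℝ) < Fintype.card (Idx P) := Nat.cast_pos.mpr Fintype.card_pos
  obtain ⟨⟨i₁, hi₁⟩, ⟨i₀, hi₀⟩⟩ := exists_onAxis_and_offAxis (P := P) c hd
  have hpos : 0 < (Finset.univ.filter onAx).card := Finset.card_pos.mpr ⟨i₁, Finset.mem_filter.mpr ⟨Finset.mem_univ _, hi₁⟩⟩
  have hlam0 : 0 < lam := div_pos (Nat.cast_pos.mpr hpos) hcardI
  have hlam1 : lam ≤ 1 := by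
    rw [hlam, div_le_one hcardI]; exact_mod_cast (Finset.card_filter_le _ _).trans (Finset.card_univ (α := Idx P)).le
  have hα : 0 ≤ α := (GaugeGroup.dist1_nonneg _).trans (hW i₀)
  have hδ := deltaSU_pos (n := n)
  have hδ3 : deltaSU n ≤ 1 / 3 := min_le_left _ _
  have hsmallα : α < deltaSU n := by nlinarith
  have hℓε : ℓ * ε ≤ 1 / 2 := by nlinarith
  -- the comparison configurations
  set u : Matrix.specialUnitaryGroup n ℂ := U (b0 c) with hu
  set V₁ : GaugeField P j (Matrix.specialUnitaryGroup n ℂ) := Function.update V (b0 c) u with hV₁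
  set V₁' : GaugeField P j (Matrix.specialUnitaryGroup n ℂ) := fun b => if ∃ c' : PBond P (j + 1), b = b0 c' then U b else V b with hV₁'
  have hpert : ∀ b, ‖pertVar V₁' U b‖ ≤ ε := by
    intro b
    by_cases hb : ∃ c' : PBond P (j + 1), b = b0 c'
    · have : V₁' b = U b := by simp only [hV₁', if_pos hb]
      rw [pertVar, this, mul_inv_cancel]
      simp [hε]
    · have : V₁' b = V b := by simp only [hV₁', if_neg hb]
      rw [pertVar, this]
      exact hF b fun c' h => hb ⟨c', h⟩
  have hagree : ∀ b : PBond P j, (∀ c' : PBond P (j + 1), c' ≠ c → b ≠ b0 c') → V₁' b = V₁ b := by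
    intro b hb
    by_cases hbc : b = b0 c
    · subst hbc
      have hex : ∃ c' : PBond P (j + 1), b0 c = b0 c' := ⟨c, rfl⟩
      simp only [hV₁', if_pos hex, hV₁, Function.update_self, hu]
    · have hnex : ¬ ∃ c' : PBond P (j + 1), b = b0 c' := by
        rintro ⟨c', hc'⟩
        by_cases hcc : c' = c
        · exact hbc (hcc ▸ hc')
        · exact hb c' hcc hc'
      simp only [hV₁', if_neg hnex, hV₁, Function.update_of_ne hbc]
  have hloops₁ : ∀ i, loopHol V₁' c i = loopHol V₁ c i := loopHol_eq_of_eqOn_offForeign hj V₁ V₁' c hagree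
  have hax₁ : axialAvg V₁' c = axialAvg V₁ c := axialAvg_eq_of_eqOn_offForeign hj V₁ V₁' c hagree
  -- the `R`-factors
  set R : Idx P → Matrix.specialUnitaryGroup n ℂ := fun i => loopHol U c i * (loopHol V₁ c i)⁻¹ with hR
  set RS : Matrix.specialUnitaryGroup n ℂ := axialAvg U c * (axialAvg V₁ c)⁻¹ with hRS
  have hRi : ∀ i, dist1 (R i) ≤ 2 * (ℓ * ε) := by
    intro i
    have hlen : (walk (emb c.src) (loopWord P.L c.dir (off i.1) i.2.1 i.2.2)).length ≤ (P.d + 2) * P.L :=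
      (BlockAveragingEMLLinearised.length_walk _ _).le.trans (LatticeWordStokes.length_loopWord_le c i)
    have h := (norm_holRatio_bounds_of_length_le V₁' U hε hpert (m := (P.d + 2) * P.L) (by rw [← hℓ]; exact hℓε) _ hlen).1
    rw [hR, dist1_eq, Submonoid.coe_mul, ← hloops₁ i, coe_inv_eq_star]
    simpa [loopHol, hℓ, mul_assoc] using h
  have hRSd : dist1 RS ≤ 2 * (ℓ * ε) := by
    have hlen : (walk (emb c.src) (List.replicate P.L (c.dir, true))).length ≤ (P.d + 2) * P.L := by
      rw [BlockAveragingEMLLinearised.length_walk, List.length_replicate]; nlinarith [P.L_pos, Nat.zero_le P.d]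
    have h := (norm_holRatio_bounds_of_length_le V₁' U hε hpert (m := (P.d + 2) * P.L) (by rw [← hℓ]; exact hℓε) _ hlen).1
    rw [hRS, dist1_eq, Submonoid.coe_mul, ← hax₁, coe_inv_eq_star, axialAvg_eq_holAt_walk, axialAvg_eq_holAt_walk]
    simpa [hℓ, mul_assoc] using h
  -- the transported fluctuation and the structure of the family
  set g : Matrix.specialUnitaryGroup n ℂ := rowProd V (emb c.src) c.dir ((P.L - 1) / 2 + 1) with hg
  set T : Matrix.specialUnitaryGroup n ℂ := g * ((V (b0 c))⁻¹ * u) * g⁻¹ with hT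
  have hRm : ∀ i, loopHol U c i = R i * loopHol V₁ c i := fun i => by rw [hR, inv_mul_cancel_right]
  have hW₁off : ∀ i, ¬ onAx i → loopHol V₁ c i = loopHol V c i * T⁻¹ := fun i hi => by
    have e := loopHol_update_b0_of_offAxis hj V c u i hi
    rw [← hg, ← hT, ← hV₁] at e
    exact e
  have hW₁on : ∀ i, onAx i → loopHol V₁ c i = T * loopHol V c i * T⁻¹ := fun i hi => by
    have e := loopHol_update_b0_of_onAxis hj V c u i hi
    rw [← hg, ← hT, ← hV₁] at e
    exact e
  have hoff : ∀ i, ¬ onAx i → loopHol U c i = R i * loopHol V c i * T⁻¹ := fun i hi =>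
    calc loopHol U c i = R i * loopHol V₁ c i := hRm i
      _ = R i * (loopHol V c i * T⁻¹) := congrArg (R i * ·) (hW₁off i hi)
      _ = R i * loopHol V c i * T⁻¹ := (mul_assoc _ _ _).symm
  have hon : ∀ i, onAx i → loopHol U c i = R i * T * loopHol V c i * T⁻¹ := fun i hi =>
    calc loopHol U c i = R i * loopHol V₁ c i := hRm i
      _ = R i * (T * loopHol V c i * T⁻¹) := congrArg (R i * ·) (hW₁on i hi)
      _ = R i * T * loopHol V c i * T⁻¹ := by simp only [mul_assoc]
  have hK : corr (expMeanLogSU (n := n)) U c * RS * T = corr (expMeanLogSU (n := n)) V c := by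
    have e1 : axialAvg V₁ c = T * axialAvg V c := by
      have e := axialAvg_update_b0 hj V c u
      rw [← hg, ← hT, ← hV₁] at e
      exact e
    have hax : axialAvg U c = RS * (T * axialAvg V c) := by
      rw [hRS, e1, inv_mul_cancel_right]
    have h := hM
    change corr (expMeanLogSU (n := n)) U c * axialAvg U c = corr (expMeanLogSU (n := n)) V c * axialAvg V c at h
    rw [hax, ← mul_assoc, ← mul_assoc] at h
    exact mul_right_cancel h
  have hsmall_iff : ∀ (X : GaugeField P j (Matrix.specialUnitaryGroup n ℂ)),
      Small (expMeanLogSU (n := n)) X c ↔ ∀ i, dist1 (loopHol X c i) < deltaSU n := fun X => Iff.rfl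
  have hKsm : (∀ i, dist1 (loopHol U c i) < deltaSU n) →
      ((corr (expMeanLogSU (n := n)) U c : Matrix.specialUnitaryGroup n ℂ) : Matrix n n ℂ) =
        eml fun i => ((loopHol U c i : Matrix.specialUnitaryGroup n ℂ) : Matrix n n ℂ) := by
    intro hsm
    unfold corr
    rw [if_pos ((hsmall_iff U).2 hsm)]
    exact BlockAveragingEMLProp2.coe_avg_eq_eml _ hsm
  have hKns : ¬ (∀ i, dist1 (loopHol U c i) < deltaSU n) → corr (expMeanLogSU (n := n)) U c = 1 := by
    intro hns
    unfold corr
    rw [if_neg (fun h => hns ((hsmall_iff U).1 h))]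
  have hVsm : ∀ i, dist1 (loopHol V c i) < deltaSU n := fun i => (hW i).trans_lt hsmallα
  have hκsm : ((corr (expMeanLogSU (n := n)) V c : Matrix.specialUnitaryGroup n ℂ) : Matrix n n ℂ) =
      eml fun i => ((loopHol V c i : Matrix.specialUnitaryGroup n ℂ) : Matrix n n ℂ) := by
    unfold corr
    rw [if_pos ((hsmall_iff V).2 hVsm)]
    exact BlockAveragingEMLProp2.coe_avg_eq_eml _ hVsm
  have hκ : dist1 (corr (expMeanLogSU (n := n)) V c) ≤ 2 * α :=
    BlockAveragingEMLProp2.dist1_corr_le_two_mul V c hW hsmallα (by nlinarith)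
  -- the abstract rider
  have hmain := dist1_le_of_fibre_identity onAx (loopHol U c) R (loopHol V c) T RS (corr (expMeanLogSU (n := n)) U c)
    (corr (expMeanLogSU (n := n)) V c) (η := 2 * (ℓ * ε)) hoff hon hRi hW hRSd hκ hK hKsm hKns hκsm hi₀ hpos
    (by rw [← hlam]; linarith) (by rw [← hlam]; linarith)
  rw [← hlam] at hmain
  rw [← dist1_inv_mul_eq_norm_pertVar, ← dist1_transportedFluct V c u, ← hg, ← hT]
  refine hmain.trans (le_of_eq ?_)
  ring

/-- **THE RIDER WITH `|Idx|`-NUMERICS** (direction-independent form: `λ ≥ 1∕|Idx|` as an on-axis index exists): `M(U)(c) = M(V)(c)`, `|U_bV_b⁻¹ − 1| ≤ ε` off the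
distinguished bonds, background loops `α`-small, `1640(2ℓε + α)|Idx|² ≤ 1`, `13(2ℓε + α)|Idx| < δ_N` ⇒ `‖U(b₀(c))V(b₀(c))⁻¹ − 1‖ ≤ 10ℓε·|Idx|`.
[cite: Balaban1987RG1, (2.9) p.266 and p.267] -/
theorem norm_pertVar_b0_le_card (hj : j + 1 ≤ P.m + P.K) (hd : 2 ≤ P.d) (U V : GaugeField P j (Matrix.specialUnitaryGroup n ℂ))
    (c : PBond P (j + 1)) {ε α : ℝ} (hε : 0 ≤ ε)
    (hM : avgFun (expMeanLogSU (n := n)) U c = avgFun (expMeanLogSU (n := n)) V c)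
    (hF : ∀ b : PBond P j, (∀ c' : PBond P (j + 1), b ≠ b0 c') → ‖pertVar V U b‖ ≤ ε)
    (hW : ∀ i, dist1 (loopHol V c i) ≤ α)
    (h1 : 1640 * (2 * ((((P.d + 2) * P.L : ℕ) : ℝ) * ε) + α) * (Fintype.card (Idx P) : ℝ) ^ 2 ≤ 1)
    (h2 : 13 * (2 * ((((P.d + 2) * P.L : ℕ) : ℝ) * ε) + α) * Fintype.card (Idx P) < deltaSU n) :
    ‖pertVar V U (b0 c)‖ ≤ 10 * ((((P.d + 2) * P.L : ℕ) : ℝ) * ε) * Fintype.card (Idx P) := by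
  classical
  set s : ℝ := 2 * ((((P.d + 2) * P.L : ℕ) : ℝ) * ε) + α with hs
  set I : ℝ := (Fintype.card (Idx P) : ℝ) with hI
  set lam : ℝ := ((Finset.univ.filter fun i : Idx P => ∀ ν, ν ≠ c.dir → (i.1 ν : ℕ) = (P.L - 1) / 2).card : ℝ) / Fintype.card (Idx P) with hlam
  have hI0 : (0 : ℝ) < I := Nat.cast_pos.mpr Fintype.card_pos
  have hI1 : 1 ≤ I := Nat.one_le_cast.mpr Fintype.card_pos
  obtain ⟨⟨i₁, hi₁⟩, ⟨i₀, -⟩⟩ := exists_onAxis_and_offAxis (P := P) c hd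
  have hpos : (1 : ℝ) ≤ ((Finset.univ.filter fun i : Idx P => ∀ ν, ν ≠ c.dir → (i.1 ν : ℕ) = (P.L - 1) / 2).card : ℝ) := by
    exact_mod_cast Finset.card_pos.mpr ⟨i₁, Finset.mem_filter.mpr ⟨Finset.mem_univ _, hi₁⟩⟩
  have hlamI : 1 ≤ lam * I := by rw [hlam, div_mul_cancel₀ _ hI0.ne']; exact hpos
  have hlam0 : 0 < lam := by nlinarith
  have hα : 0 ≤ α := (GaugeGroup.dist1_nonneg _).trans (hW i₀)
  have hs0 : 0 ≤ s := by rw [hs]; positivity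
  have hδ := deltaSU_pos (n := n)
  -- `1∕I ≤ λ` turns the `|Idx|`-numerics into the `λ`-numerics
  have h1' : 1640 * s ≤ lam ^ 2 := by
    have hmono : 1640 * s * I ^ 2 ≤ lam ^ 2 * I ^ 2 :=
      calc 1640 * s * I ^ 2 ≤ 1 := h1
        _ ≤ (lam * I) ^ 2 := by nlinarith
        _ = lam ^ 2 * I ^ 2 := by ring
    exact le_of_mul_le_mul_right hmono (by positivity)
  have h2' : 13 * s < lam * deltaSU n := by
    have hmono : 13 * s * I < lam * deltaSU n * I :=
      calc 13 * s * I < deltaSU n := h2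
        _ ≤ deltaSU n * (lam * I) := by nlinarith
        _ = lam * deltaSU n * I := by ring
    exact lt_of_mul_lt_mul_right hmono hI0.le
  have h := norm_pertVar_b0_le hj hd U V c hε hM hF hW (by rw [← hlam]; exact h1') (by rw [← hlam]; exact h2')
  rw [← hlam] at h
  refine h.trans ?_
  rw [div_le_iff₀ hlam0]
  have : 0 ≤ 10 * ((((P.d + 2) * P.L : ℕ) : ℝ) * ε) := by positivity
  nlinarith

/-- **THE ON-AXIS INDICES NUMBER `L·(d!)²`** out of `|Idx| = L^d·(d!)²` (`λ = L^{1−d}`): the offsets `r` with `r_ν = (L−1)/2` for `ν ≠ μ` are parametrised by `r_μ ∈ Fin L`,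
the two orderings are free. [cite: Balaban1987RG1, (0.4) p.253 (bookkeeping)] -/
theorem card_filter_onAxis (μ : Fin P.d) :
    (Finset.univ.filter fun i : Idx P => ∀ ν, ν ≠ μ → (i.1 ν : ℕ) = (P.L - 1) / 2).card =
      P.L * Fintype.card (Equiv.Perm (Fin P.d)) ^ 2 := by
  classical
  rw [← Fintype.card_subtype]
  let e : {i : Idx P // ∀ ν, ν ≠ μ → (i.1 ν : ℕ) = (P.L - 1) / 2} ≃
      {r : Fin P.d → Fin P.L // ∀ ν, ν ≠ μ → (r ν : ℕ) = (P.L - 1) / 2} × (Equiv.Perm (Fin P.d) × Equiv.Perm (Fin P.d)) :=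
    { toFun := fun i => (⟨i.1.1, i.2⟩, i.1.2)
      invFun := fun q => ⟨(q.1.1, q.2), q.1.2⟩
      left_inv := fun i => rfl
      right_inv := fun q => rfl }
  let e2 : {r : Fin P.d → Fin P.L // ∀ ν, ν ≠ μ → (r ν : ℕ) = (P.L - 1) / 2} ≃ Fin P.L :=
    { toFun := fun r => r.1 μ
      invFun := fun t => ⟨Function.update (fun _ => ⟨(P.L - 1) / 2, half_lt P⟩) μ t, fun ν hν => by
        rw [Function.update_of_ne hν]⟩
      left_inv := fun r => by
        apply Subtype.ext
        funext ν
        show Function.update (fun _ => (⟨(P.L - 1) / 2, half_lt P⟩ : Fin P.L)) μ (r.1 μ) ν = r.1 ν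
        by_cases hν : ν = μ
        · subst hν; simp
        · rw [Function.update_of_ne hν]; exact Fin.ext (r.2 ν hν).symm
      right_inv := fun t => by simp }
  rw [Fintype.card_congr e, Fintype.card_prod, Fintype.card_prod, Fintype.card_congr e2, Fintype.card_fin]
  ring

/-- Hence `λ = |on-axis|∕|Idx| = L^{1−d}`. [cite: Balaban1987RG1, (0.4) p.253 (bookkeeping)] -/
theorem onAxis_ratio_eq (μ : Fin P.d) :
    ((Finset.univ.filter fun i : Idx P => ∀ ν, ν ≠ μ → (i.1 ν : ℕ) = (P.L - 1) / 2).card : ℝ) / Fintype.card (Idx P) =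
      (((P.L : ℝ) ^ (P.d - 1)))⁻¹ := by
  rw [card_filter_onAxis, BlockAveragingEMLLinearised.card_idx]
  have hL : (0 : ℝ) < P.L := by exact_mod_cast P.L_pos
  have hp : (0 : ℝ) < Fintype.card (Equiv.Perm (Fin P.d)) := by exact_mod_cast Fintype.card_pos
  have hd : 1 ≤ P.d := P.hd
  push_cast
  have e : ((P.L : ℝ)) ^ P.d = (P.L : ℝ) * (P.L : ℝ) ^ (P.d - 1) := by
    rw [← pow_succ', Nat.sub_add_cancel hd]
  rw [e]
  field_simp


/-- **THE RIDER WITH `λ = L^{1−d}` MADE EXPLICIT**: `M(U)(c) = M(V)(c)`, `|U_bV_b⁻¹ − 1| ≤ ε` off the distinguished bonds, background loops `α`-small,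
`1640(2ℓε + α)·L^{2(d−1)} ≤ 1`, `13(2ℓε + α)·L^{d−1} < δ_N` ⇒ `‖U(b₀(c))V(b₀(c))⁻¹ − 1‖ ≤ 10ℓε·L^{d−1}` (`ℓ = (d+2)L`; print's «O(ε₁)» with the constant
`10(d+2)L^d`). [cite: Balaban1987RG1, (2.9) p.266 and p.267] -/
theorem norm_pertVar_b0_le_pow (hj : j + 1 ≤ P.m + P.K) (hd : 2 ≤ P.d) (U V : GaugeField P j (Matrix.specialUnitaryGroup n ℂ))
    (c : PBond P (j + 1)) {ε α : ℝ} (hε : 0 ≤ ε)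
    (hM : avgFun (expMeanLogSU (n := n)) U c = avgFun (expMeanLogSU (n := n)) V c)
    (hF : ∀ b : PBond P j, (∀ c' : PBond P (j + 1), b ≠ b0 c') → ‖pertVar V U b‖ ≤ ε)
    (hW : ∀ i, dist1 (loopHol V c i) ≤ α)
    (h1 : 1640 * (2 * ((((P.d + 2) * P.L : ℕ) : ℝ) * ε) + α) * ((P.L : ℝ) ^ (P.d - 1)) ^ 2 ≤ 1)
    (h2 : 13 * (2 * ((((P.d + 2) * P.L : ℕ) : ℝ) * ε) + α) * (P.L : ℝ) ^ (P.d - 1) < deltaSU n) :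
    ‖pertVar V U (b0 c)‖ ≤ 10 * ((((P.d + 2) * P.L : ℕ) : ℝ) * ε) * (P.L : ℝ) ^ (P.d - 1) := by
  set s : ℝ := 2 * ((((P.d + 2) * P.L : ℕ) : ℝ) * ε) + α with hs
  set Λ : ℝ := (P.L : ℝ) ^ (P.d - 1) with hΛ
  have hΛ0 : 0 < Λ := by rw [hΛ]; exact pow_pos (by exact_mod_cast P.L_pos) _
  have hlam : ((Finset.univ.filter fun i : Idx P => ∀ ν, ν ≠ c.dir → (i.1 ν : ℕ) = (P.L - 1) / 2).card : ℝ) / Fintype.card (Idx P) = Λ⁻¹ := by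
    rw [onAxis_ratio_eq]
  obtain ⟨-, ⟨i₀, -⟩⟩ := exists_onAxis_and_offAxis (P := P) c hd
  have hα : 0 ≤ α := (GaugeGroup.dist1_nonneg _).trans (hW i₀)
  have hs0 : 0 ≤ s := by rw [hs]; positivity
  have hδ := deltaSU_pos (n := n)
  -- `Λ⁻¹ = λ`: divide the numerics by powers of `Λ`
  have h1' : 1640 * s ≤ (Λ⁻¹) ^ 2 := by
    rw [inv_pow, ← one_div, le_div_iff₀ (by positivity)]
    exact h1
  have h2' : 13 * s < Λ⁻¹ * deltaSU n := by
    rw [inv_mul_eq_div, lt_div_iff₀ hΛ0]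
    exact h2
  have h := norm_pertVar_b0_le hj hd U V c hε hM hF hW (by rw [hlam]; exact h1') (by rw [hlam]; exact h2')
  rw [hlam] at h
  refine h.trans (le_of_eq ?_)
  field_simp

end Concrete

end B12B0RestrictionNonlinear267

end Literature.MathematicalPhysics.QuantumFieldTheory.Balaban1983to89

end
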